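import Mathlib
import Summits.NavierStokesRegularity.NavierStokesRegularity.Theorems.EulerZoomLiouvillePowerGaugeEulerLiouvilleCondenserGradientRiccati

/-!
# THEOREM N — THE TRACE IDENTITY AND «HESSIAN-FREE ⇒ NILPOTENT» (nsreg-p2 g34 ROUND-44 §2, plate t46-N: (N1), (N2))

Width piece for crux `EulerZoomLiouville.PowerGaugeEulerLiouville` (stmt-NavierStokesRegularity-19832), by name under LEAD 19832
(ns-typeII-p2 g13); seat ns-ezl-w2 g4, `--supports stmt-NavierStokesRegularity-19832 --as helper`.  Texts = nsreg-p2's Sketch44 Props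
`NsregP2.R44.TraceIdentity`, `…NilpotentOfHessianFree` binder-for-binder (`E3` spelled out).

For a self-similar Euler profile `(U, P)` (CIV (3.3), centre `0`, `W y = γy + U y`), the DIFFERENTIATED profile equation
(`Condenser.fderiv_gradient_pressure_eq`, t45-R: `D(∇P) = −((1−γ)DU + DU∘(γ·id + DU) + D²U(W,·))`) gives:

* `trace_fderiv_fderiv_apply_eq_zero` — `tr (D²U(y) w) = 0` (`= (w·∇) tr DU`, and `div U = 0`);
* (N1) **`trace_fderiv_comp_fderiv_eq_neg_divergence_gradient`** — `tr ((DU y)²) = −ΔP(y) = −div (∇P) (y)` (exact, class-free; the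
  `Q`-criterion `ΔP = ½‖curl U‖² − |S|²` in similarity form);
* `trace_comp_comp_eq_zero_of_hessianFree` — on an open set where `D(∇P) = 0`: `tr ((DU)³) = 0` (differentiate `tr (DU)² ≡ 0` along `W`:
  `(W·∇)DU = D²U(W,·) = −DU − (DU)²` there, so `0 = −2 tr (DU)² − 2 tr (DU)³`);
* `Matrix.mul_mul_self_eq_zero_of_trace_fin_three` — a real `3 × 3` matrix with `tr A = tr A² = tr A³ = 0` has `A³ = 0` (Newton + Cayley–Hamilton
  in dimension three, by brute force);
* (N2) **`fderiv_pow_three_eq_zero_of_hessianFree`** — HESSIAN-FREE ⇒ NILPOTENT: `D(∇P) = 0` on an open `O` ⇒ `(DU y)³ = 0` for `y ∈ O`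
  («pressure-transparent regions carry vortex-SHEET kinematics only»);
* `traceIdentity`, `nilpotentOfHessianFree` — the Sketch44 texts.

HONEST FRAMING: calculus / linear algebra for HYPOTHETICAL self-similar Euler profiles (MODEL lattice of the crux class); nothing here proves
the crux E (19832 OPEN), any door Target, or Navier–Stokes regularity. [cite: ConstantinIgnatovaVicol2026Putative, §3.1.1 eq. (3.3)]
-/

noncomputable section

open Set Filter Topology Metric Function InnerProductSpace
open scoped RealInnerProductSpace

set_option linter.dupNamespace false

namespace Summit.NavierStokesRegularity.NavierStokesRegularity.Theorems.PowerGaugeEulerLiouville.TraceCascade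

open Literature.Analysis Literature.Analysis.FluidPDE
open Summit.NavierStokesRegularity.NavierStokesRegularity.Theorems.PowerGaugeEulerLiouville

variable {γ : ℝ} {U : EuclideanSpace ℝ (Fin 3) → EuclideanSpace ℝ (Fin 3)} {P : EuclideanSpace ℝ (Fin 3) → ℝ}

/-! ### Linear algebra in dimension three: `tr A = tr A² = tr A³ = 0 ⇒ A³ = 0` -/

/-- **Cayley–Hamilton for a real `3 × 3` matrix, with the middle coefficient from Newton's identity**:
`A³ = (tr A)·A² − ½((tr A)² − tr A²)·A + (det A)·1` (brute force). [folklore] -/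
theorem Matrix.cayleyHamilton_fin_three (A : Matrix (Fin 3) (Fin 3) ℝ) :
    A * A * A = A.trace • (A * A) - (((A.trace) ^ 2 - (A * A).trace) / 2) • A + A.det • (1 : Matrix (Fin 3) (Fin 3) ℝ) := by
  ext i j
  fin_cases i <;> fin_cases j <;>
    simp [Matrix.mul_apply, Fin.sum_univ_three, Matrix.trace_fin_three, Matrix.det_fin_three] <;> ring

/-- **`det A` from traces of powers** (Newton's identity in dimension three): `6 det A = (tr A)³ − 3 tr A · tr A² + 2 tr A³`. [folklore] -/
theorem Matrix.det_fin_three_eq_traces (A : Matrix (Fin 3) (Fin 3) ℝ) :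
    A.det = ((A.trace) ^ 3 - 3 * A.trace * (A * A).trace + 2 * (A * A * A).trace) / 6 := by
  simp [Matrix.mul_apply, Fin.sum_univ_three, Matrix.trace_fin_three, Matrix.det_fin_three]
  ring

/-- **A real `3 × 3` matrix with `tr A = tr A² = tr A³ = 0` satisfies `A³ = 0`.** [folklore] -/
theorem Matrix.mul_mul_self_eq_zero_of_trace_fin_three {A : Matrix (Fin 3) (Fin 3) ℝ} (h1 : A.trace = 0)
    (h2 : (A * A).trace = 0) (h3 : (A * A * A).trace = 0) : A * A * A = 0 := by
  rw [Matrix.cayleyHamilton_fin_three A, Matrix.det_fin_three_eq_traces A, h1, h2, h3]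
  simp

/-! ### Traces of the differentiated profile equation -/

/-- `tr DU(x) = 0` in linear-map form. [cite: ConstantinIgnatovaVicol2026Putative, §3.1.1 eq. (3.3)] -/
theorem trace_fderiv_eq_zero (hprof : IsSelfSimilarEulerProfile γ 0 U P) (x : EuclideanSpace ℝ (Fin 3)) :
    LinearMap.trace ℝ (EuclideanSpace ℝ (Fin 3))
      (fderiv ℝ U x : EuclideanSpace ℝ (Fin 3) →ₗ[ℝ] EuclideanSpace ℝ (Fin 3)) = 0 :=
  hprof.divFree x

/-- **`tr (D²U(y) w) = 0`**: the trace of the second derivative in any direction vanishes (`div U ≡ 0` differentiated).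
[cite: ConstantinIgnatovaVicol2026Putative, §3.1.1 eq. (3.3)] -/
theorem trace_fderiv_fderiv_apply_eq_zero (hprof : IsSelfSimilarEulerProfile γ 0 U P) (y w : EuclideanSpace ℝ (Fin 3)) :
    LinearMap.trace ℝ (EuclideanSpace ℝ (Fin 3))
      (fderiv ℝ (fderiv ℝ U) y w : EuclideanSpace ℝ (Fin 3) →ₗ[ℝ] EuclideanSpace ℝ (Fin 3)) = 0 := by
  -- the trace as a continuous linear functional on `E →L E`
  let T : (EuclideanSpace ℝ (Fin 3) →L[ℝ] EuclideanSpace ℝ (Fin 3)) →L[ℝ] ℝ :=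
    LinearMap.toContinuousLinearMap
      ((LinearMap.trace ℝ (EuclideanSpace ℝ (Fin 3))).comp (ContinuousLinearMap.coeLM ℝ))
  have hT : ∀ A : EuclideanSpace ℝ (Fin 3) →L[ℝ] EuclideanSpace ℝ (Fin 3),
      T A = LinearMap.trace ℝ (EuclideanSpace ℝ (Fin 3)) (A : EuclideanSpace ℝ (Fin 3) →ₗ[ℝ] EuclideanSpace ℝ (Fin 3)) :=
    fun A => rfl
  -- `x ↦ T (DU x)` is identically zero, with derivative `T ∘ D²U(y)` at `y`
  have hΦ : HasFDerivAt (fun x => T (fderiv ℝ U x)) (T.comp (fderiv ℝ (fderiv ℝ U) y)) y :=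
    T.hasFDerivAt.comp y (Condenser.hasFDerivAt_fderiv_velocity hprof y)
  have hzero : (fun x => T (fderiv ℝ U x)) = fun _ => (0 : ℝ) := by
    funext x; rw [hT]; exact hprof.divFree x
  have h0 : HasFDerivAt (fun x => T (fderiv ℝ U x))
      (0 : EuclideanSpace ℝ (Fin 3) →L[ℝ] ℝ) y := by
    rw [hzero]; exact hasFDerivAt_const 0 y
  have huniq := hΦ.unique h0
  have h := congrArg (fun L : EuclideanSpace ℝ (Fin 3) →L[ℝ] ℝ => L w) huniq
  simp only [ContinuousLinearMap.comp_apply, _root_.zero_apply] at h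
  rw [hT] at h
  exact h

/-- **(N1) THE TRACE IDENTITY**: `tr ((DU y)∘(DU y)) = −div (∇P) (y)` (`= −ΔP(y)`).  Trace of the differentiated profile equation:
`tr D(∇P) = −((1−γ)·0 + (γ·0 + tr DU²) + 0)`. [cite: ConstantinIgnatovaVicol2026Putative, §3.1.1 eq. (3.3)] -/
theorem trace_fderiv_comp_fderiv_eq_neg_divergence_gradient (hprof : IsSelfSimilarEulerProfile γ 0 U P)
    (y : EuclideanSpace ℝ (Fin 3)) :
    LinearMap.trace ℝ (EuclideanSpace ℝ (Fin 3))
        (((fderiv ℝ U y).comp (fderiv ℝ U y) : EuclideanSpace ℝ (Fin 3) →L[ℝ] EuclideanSpace ℝ (Fin 3)) :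
          EuclideanSpace ℝ (Fin 3) →ₗ[ℝ] EuclideanSpace ℝ (Fin 3)) =
      -VectorCalculus.divergence (gradient P) y := by
  have htr0 := trace_fderiv_eq_zero hprof y
  have htr2 : LinearMap.trace ℝ (EuclideanSpace ℝ (Fin 3))
      (((fderiv ℝ (fderiv ℝ U) y).flip (selfSimilarTransport γ 0 U y) :
        EuclideanSpace ℝ (Fin 3) →L[ℝ] EuclideanSpace ℝ (Fin 3)) :
        EuclideanSpace ℝ (Fin 3) →ₗ[ℝ] EuclideanSpace ℝ (Fin 3)) = 0 := by
    rw [← Condenser.fderiv_fderiv_apply_eq_flip hprof y]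
    exact trace_fderiv_fderiv_apply_eq_zero hprof y _
  unfold VectorCalculus.divergence
  rw [Condenser.fderiv_gradient_pressure_eq hprof y]
  have hcomp : (fderiv ℝ U y).comp (γ • ContinuousLinearMap.id ℝ (EuclideanSpace ℝ (Fin 3)) + fderiv ℝ U y) =
      γ • fderiv ℝ U y + (fderiv ℝ U y).comp (fderiv ℝ U y) := by
    rw [ContinuousLinearMap.comp_add, ContinuousLinearMap.comp_smul, ContinuousLinearMap.comp_id]
  rw [hcomp]
  simp only [ContinuousLinearMap.toLinearMap_neg, ContinuousLinearMap.toLinearMap_add, ContinuousLinearMap.toLinearMap_smul,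
    map_neg, map_add, map_smul, htr0, htr2, smul_zero, zero_add, add_zero, neg_neg]

/-- **On a Hessian-free open set, `tr (DU)² = 0`.** [cite: ConstantinIgnatovaVicol2026Putative, §3.1.1 eq. (3.3)] -/
theorem trace_comp_eq_zero_of_hessianFree (hprof : IsSelfSimilarEulerProfile γ 0 U P) {y : EuclideanSpace ℝ (Fin 3)}
    (hHess : fderiv ℝ (gradient P) y = 0) :
    LinearMap.trace ℝ (EuclideanSpace ℝ (Fin 3))
        (((fderiv ℝ U y).comp (fderiv ℝ U y) : EuclideanSpace ℝ (Fin 3) →L[ℝ] EuclideanSpace ℝ (Fin 3)) :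
          EuclideanSpace ℝ (Fin 3) →ₗ[ℝ] EuclideanSpace ℝ (Fin 3)) = 0 := by
  rw [trace_fderiv_comp_fderiv_eq_neg_divergence_gradient hprof y]
  unfold VectorCalculus.divergence
  rw [hHess]
  simp

/-- **On a Hessian-free open set the transport of `DU` is algebraic**: `D²U(y)(W y) = −DU(y) − DU(y)∘DU(y)`.
[cite: ConstantinIgnatovaVicol2026Putative, §3.1.1 eq. (3.3)] -/
theorem fderiv_fderiv_transport_eq_of_hessianFree (hprof : IsSelfSimilarEulerProfile γ 0 U P) {y : EuclideanSpace ℝ (Fin 3)}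
    (hHess : fderiv ℝ (gradient P) y = 0) :
    fderiv ℝ (fderiv ℝ U) y (selfSimilarTransport γ 0 U y) = -(fderiv ℝ U y) - (fderiv ℝ U y).comp (fderiv ℝ U y) := by
  have e := Condenser.fderiv_gradient_pressure_eq hprof y
  rw [hHess, ContinuousLinearMap.comp_add, ContinuousLinearMap.comp_smul, ContinuousLinearMap.comp_id] at e
  rw [Condenser.fderiv_fderiv_apply_eq_flip hprof y]
  have e2 : (fderiv ℝ (fderiv ℝ U) y).flip (selfSimilarTransport γ 0 U y) =
      -((1 - γ) • fderiv ℝ U y + (γ • fderiv ℝ U y + (fderiv ℝ U y).comp (fderiv ℝ U y))) := by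
    linear_combination (norm := module) e
  rw [e2]
  module

/-- **On a Hessian-free open set, `tr (DU)³ = 0`** — differentiate `tr (DU)² ≡ 0` along `W`. [cite: ConstantinIgnatovaVicol2026Putative, §3.1.1 eq. (3.3)] -/
theorem trace_comp_comp_eq_zero_of_hessianFree (hprof : IsSelfSimilarEulerProfile γ 0 U P) {O : Set (EuclideanSpace ℝ (Fin 3))}
    (hO : IsOpen O) (hHess : ∀ y ∈ O, fderiv ℝ (gradient P) y = 0) {y : EuclideanSpace ℝ (Fin 3)} (hy : y ∈ O) :
    LinearMap.trace ℝ (EuclideanSpace ℝ (Fin 3))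
        (((fderiv ℝ U y).comp ((fderiv ℝ U y).comp (fderiv ℝ U y)) : EuclideanSpace ℝ (Fin 3) →L[ℝ] EuclideanSpace ℝ (Fin 3)) :
          EuclideanSpace ℝ (Fin 3) →ₗ[ℝ] EuclideanSpace ℝ (Fin 3)) = 0 := by
  let T : (EuclideanSpace ℝ (Fin 3) →L[ℝ] EuclideanSpace ℝ (Fin 3)) →L[ℝ] ℝ :=
    LinearMap.toContinuousLinearMap
      ((LinearMap.trace ℝ (EuclideanSpace ℝ (Fin 3))).comp (ContinuousLinearMap.coeLM ℝ))
  have hT : ∀ A : EuclideanSpace ℝ (Fin 3) →L[ℝ] EuclideanSpace ℝ (Fin 3),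
      T A = LinearMap.trace ℝ (EuclideanSpace ℝ (Fin 3)) (A : EuclideanSpace ℝ (Fin 3) →ₗ[ℝ] EuclideanSpace ℝ (Fin 3)) :=
    fun A => rfl
  set D := fderiv ℝ U y with hD
  set D2 := fderiv ℝ (fderiv ℝ U) y with hD2
  -- `Φ x = tr (DU x ∘ DU x)` vanishes on `O`, hence has derivative `0` at `y`
  have hd : HasFDerivAt (fderiv ℝ U) D2 y := Condenser.hasFDerivAt_fderiv_velocity hprof y
  have hΦ : HasFDerivAt (fun x => T ((fderiv ℝ U x).comp (fderiv ℝ U x)))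
      (T.comp ((ContinuousLinearMap.compL ℝ (EuclideanSpace ℝ (Fin 3)) (EuclideanSpace ℝ (Fin 3)) (EuclideanSpace ℝ (Fin 3)) D).comp D2 +
        ((ContinuousLinearMap.compL ℝ (EuclideanSpace ℝ (Fin 3)) (EuclideanSpace ℝ (Fin 3)) (EuclideanSpace ℝ (Fin 3))).flip D).comp D2)) y :=
    T.hasFDerivAt.comp y (hd.clm_comp hd)
  have hzero : (fun x => T ((fderiv ℝ U x).comp (fderiv ℝ U x))) =ᶠ[𝓝 y] fun _ => (0 : ℝ) := by
    filter_upwards [hO.mem_nhds hy] with x hx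
    rw [hT]
    exact trace_comp_eq_zero_of_hessianFree hprof (hHess x hx)
  have h0 : HasFDerivAt (fun x => T ((fderiv ℝ U x).comp (fderiv ℝ U x))) (0 : EuclideanSpace ℝ (Fin 3) →L[ℝ] ℝ) y :=
    (hasFDerivAt_const (0 : ℝ) y).congr_of_eventuallyEq hzero
  have huniq := hΦ.unique h0
  have h := congrArg (fun L : EuclideanSpace ℝ (Fin 3) →L[ℝ] ℝ => L (selfSimilarTransport γ 0 U y)) huniq
  simp only [ContinuousLinearMap.comp_apply, _root_.add_apply, ContinuousLinearMap.compL_apply,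
    ContinuousLinearMap.flip_apply, _root_.zero_apply] at h
  -- `D²U(y)(W y) = −D − D∘D`
  have hM : D2 (selfSimilarTransport γ 0 U y) = -D - D.comp D := by
    rw [hD2, hD]; exact fderiv_fderiv_transport_eq_of_hessianFree hprof (hHess y hy)
  rw [hM, map_add, hT, hT] at h
  have htr2 : LinearMap.trace ℝ (EuclideanSpace ℝ (Fin 3))
      ((D.comp D : EuclideanSpace ℝ (Fin 3) →L[ℝ] EuclideanSpace ℝ (Fin 3)) :
        EuclideanSpace ℝ (Fin 3) →ₗ[ℝ] EuclideanSpace ℝ (Fin 3)) = 0 := by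
    rw [hD]; exact trace_comp_eq_zero_of_hessianFree hprof (hHess y hy)
  -- expand the two traces
  have e1 : D.comp (-D - D.comp D) = -(D.comp D) - D.comp (D.comp D) := by
    rw [ContinuousLinearMap.comp_sub, ContinuousLinearMap.comp_neg]
  have e2 : (-D - D.comp D).comp D = -(D.comp D) - D.comp (D.comp D) := by
    rw [ContinuousLinearMap.sub_comp, ContinuousLinearMap.neg_comp, ContinuousLinearMap.comp_assoc]
  rw [e1, e2] at h
  simp only [ContinuousLinearMap.toLinearMap_sub, ContinuousLinearMap.toLinearMap_neg, map_sub, map_neg, htr2, neg_zero,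
    zero_sub] at h
  linarith

/-! ### (N2) Hessian-free ⇒ nilpotent -/

/-- **(N2) HESSIAN-FREE ⇒ NILPOTENT**: if `D(∇P) = 0` on an open set `O`, then `(DU y)³ = 0` for `y ∈ O` (`tr DU = tr DU² = tr DU³ = 0`,
then Newton + Cayley–Hamilton in dimension three). [cite: ConstantinIgnatovaVicol2026Putative, §3.1.1 eq. (3.3)] -/
theorem fderiv_pow_three_eq_zero_of_hessianFree (hprof : IsSelfSimilarEulerProfile γ 0 U P) {O : Set (EuclideanSpace ℝ (Fin 3))}
    (hO : IsOpen O) (hHess : ∀ y ∈ O, fderiv ℝ (gradient P) y = 0) {y : EuclideanSpace ℝ (Fin 3)} (hy : y ∈ O) :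
    (fderiv ℝ U y) ^ 3 = 0 := by
  set f : EuclideanSpace ℝ (Fin 3) →ₗ[ℝ] EuclideanSpace ℝ (Fin 3) :=
    (fderiv ℝ U y : EuclideanSpace ℝ (Fin 3) →ₗ[ℝ] EuclideanSpace ℝ (Fin 3)) with hf
  let b := (EuclideanSpace.basisFun (Fin 3) ℝ).toBasis
  set A : Matrix (Fin 3) (Fin 3) ℝ := LinearMap.toMatrix b b f with hA
  have h1 : A.trace = 0 := by
    rw [hA, ← LinearMap.trace_eq_matrix_trace ℝ b f, hf]
    exact trace_fderiv_eq_zero hprof y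
  have hff : LinearMap.toMatrix b b (f * f) = A * A := by rw [LinearMap.toMatrix_mul, hA]
  have hfff : LinearMap.toMatrix b b (f * f * f) = A * A * A := by rw [LinearMap.toMatrix_mul, hff, hA]
  have h2 : (A * A).trace = 0 := by
    rw [← hff, ← LinearMap.trace_eq_matrix_trace ℝ b]
    exact trace_comp_eq_zero_of_hessianFree hprof (hHess y hy)
  have h3 : (A * A * A).trace = 0 := by
    rw [← hfff, ← LinearMap.trace_eq_matrix_trace ℝ b, mul_assoc]
    exact trace_comp_comp_eq_zero_of_hessianFree hprof hO hHess hy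
  have hA3 : A * A * A = 0 := Matrix.mul_mul_self_eq_zero_of_trace_fin_three h1 h2 h3
  have hf3 : f * f * f = 0 := by
    have : LinearMap.toMatrix b b (f * f * f) = LinearMap.toMatrix b b 0 := by rw [hfff, hA3, map_zero]
    exact (LinearMap.toMatrix b b).injective this
  -- back to the continuous linear map
  refine ContinuousLinearMap.ext fun v => ?_
  have hv := congrArg (fun g : EuclideanSpace ℝ (Fin 3) →ₗ[ℝ] EuclideanSpace ℝ (Fin 3) => g v) hf3
  simp only [Module.End.mul_apply, LinearMap.zero_apply, hf, ContinuousLinearMap.coe_coe] at hv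
  rw [pow_succ, pow_two]
  exact hv

/-! ### The Sketch44 texts, binder-for-binder -/

/-- **`NsregP2.R44.TraceIdentity`** (Sketch44 of nsreg-p2 g34, plate t46-N; `E3` spelled out). [cite: ConstantinIgnatovaVicol2026Putative, §3.1.1 eq. (3.3)] -/
theorem traceIdentity :
    ∀ (γ : ℝ) (U : EuclideanSpace ℝ (Fin 3) → EuclideanSpace ℝ (Fin 3)) (P : EuclideanSpace ℝ (Fin 3) → ℝ),
      IsSelfSimilarEulerProfile γ 0 U P →
      ∀ y : EuclideanSpace ℝ (Fin 3),
        LinearMap.trace ℝ (EuclideanSpace ℝ (Fin 3))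
            (((fderiv ℝ U y).comp (fderiv ℝ U y) : EuclideanSpace ℝ (Fin 3) →L[ℝ] EuclideanSpace ℝ (Fin 3)) :
              EuclideanSpace ℝ (Fin 3) →ₗ[ℝ] EuclideanSpace ℝ (Fin 3)) =
          -VectorCalculus.divergence (gradient P) y :=
  fun _ _ _ hprof y => trace_fderiv_comp_fderiv_eq_neg_divergence_gradient hprof y

/-- **`NsregP2.R44.NilpotentOfHessianFree`** (Sketch44, plate t46-N; `E3` spelled out). [cite: ConstantinIgnatovaVicol2026Putative, §3.1.1 eq. (3.3)] -/
theorem nilpotentOfHessianFree :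
    ∀ (γ : ℝ) (U : EuclideanSpace ℝ (Fin 3) → EuclideanSpace ℝ (Fin 3)) (P : EuclideanSpace ℝ (Fin 3) → ℝ),
      IsSelfSimilarEulerProfile γ 0 U P →
      ∀ O : Set (EuclideanSpace ℝ (Fin 3)), IsOpen O → (∀ y ∈ O, fderiv ℝ (gradient P) y = 0) →
        ∀ y ∈ O, (fderiv ℝ U y) ^ 3 = 0 :=
  fun _ _ _ hprof _ hO hHess _ hy => fderiv_pow_three_eq_zero_of_hessianFree hprof hO hHess hy

end Summit.NavierStokesRegularity.NavierStokesRegularity.Theorems.PowerGaugeEulerLiouville.TraceCascade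

end
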